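import Mathlib
import Summits.Ventures.PercRepro2.Defs
import Summits.Ventures.PercRepro2.Independence
import Summits.Ventures.PercRepro2.Harris
import Summits.Ventures.PercRepro2.Graph
import Summits.Ventures.PercRepro2.Exploration
import Summits.Ventures.PercRepro2.Events
import Summits.Ventures.PercRepro2.FourFunctions
import Summits.Ventures.PercRepro2.Induced
import Summits.Ventures.PercRepro2.Frontier
import Summits.Ventures.PercRepro2.ObsIndependence
import Summits.Ventures.PercRepro2.BHK
import Summits.Ventures.PercRepro2.BHKEvents
import Summits.Ventures.PercRepro2.OrderPreservation
import Summits.Ventures.PercRepro2.OrderPreservationDual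
import Summits.Ventures.PercRepro2.VdBKahn
import Summits.Ventures.PercRepro2.BHKAvoid
import Summits.Ventures.PercRepro2.R2PrimeThreeReduction
import Summits.Ventures.PercRepro2.YBridge
import Summits.Ventures.PercRepro2.Yu1Functionals
import Summits.Ventures.PercRepro2.Yu1Events
import Summits.Ventures.PercRepro2.Yu1
import Summits.Ventures.PercRepro2.LBSplit
import Summits.Ventures.PercRepro2.YDelta
import Summits.Ventures.PercRepro2.SD

/-!
# (SD)_h: the heavy-side facts of the up-set family (blind cell PercRepro2, typer-1)

Heavy cluster `C₂` explored on `R_h = {a₁, a₃ ∉ C₂}`, `T′ = TEvent a₂ a₁ a₃ = {a₂ ∉ C₁, a₃ ∈ C₁}`,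
`R_h = PD ⊔ T′` (`prob_PD_add_T_ob_heavy`, `Nl_eq_heavy`); heavy bookkeeping `Thl_sub_deltaH`
(`T_{h→l} − Δ_h = P(o ∈ C₂, b ∈ C₁, R_h) − P(o ∈ C₂, b ∈ C₂, T′)`);
`SDHeavy_principal_iff` (`𝒰 = {S | o ∈ S}` is exactly `Yu2Delta`), `SDHeavy_univ_iff` (`𝒰 = univ`
is `W_l ≤ W_h`), `Yu2Delta_of_SDHeavyUp`.
-/

namespace Summit.Ventures.PercRepro2

open UnionCluster Yu1

section SDHeavyFacts

variable {V : Type*} {E : Type*} [Fintype E] [DecidableEq E] [Fintype V] [DecidableEq V]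
  {R : Type*} [Field R] [LinearOrder R] [IsStrictOrderedRing R]

omit [Fintype V] [LinearOrder R] [IsStrictOrderedRing R] in
/-- Heavy mirror of `prob_PD_add_T_ob`:
`P(PD, o ∈ C₂, b ∈ C₁) + P(T′, o ∈ C₂, b ∈ C₁) = P(o ∈ C₂, b ∈ C₁, R_h)`, `R_h = {a₁, a₃ ∉ C₂}`. -/
lemma prob_PD_add_T_ob_heavy (p : E → R) (ends : E → Sym2 V) (o a₁ a₂ a₃ b : V) :
    prob p (PDEvent ends a₁ a₂ a₃ ∩ connEvent ends a₂ o ∩ connEvent ends a₁ b) +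
        prob p (TEvent ends a₂ a₁ a₃ ∩ connEvent ends a₂ o ∩ connEvent ends a₁ b) =
      prob p (connEvent ends a₂ o ∩ connEvent ends a₁ b ∩ avoidAll ends a₂ {a₁, a₃}) := by
  have h := prob_inter_add_prob_inter_compl p
    (connEvent ends a₂ o ∩ connEvent ends a₁ b ∩ avoidAll ends a₂ {a₁, a₃}) (connEvent ends a₁ a₃)
  have e1 : connEvent ends a₂ o ∩ connEvent ends a₁ b ∩ avoidAll ends a₂ {a₁, a₃} ∩
      connEvent ends a₁ a₃ = TEvent ends a₂ a₁ a₃ ∩ connEvent ends a₂ o ∩ connEvent ends a₁ b := by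
    ext ω
    simp only [Set.mem_inter_iff, mem_connEvent, avoidAll, Finset.mem_insert, Finset.mem_singleton,
      TEvent, Set.mem_setOf_eq, Set.mem_compl_iff]
    constructor
    · rintro ⟨⟨⟨ho, hb⟩, hR⟩, h13⟩
      exact ⟨⟨⟨fun h' => hR _ (Or.inl rfl) (conn_symm h'), h13⟩, ho⟩, hb⟩
    · rintro ⟨⟨⟨h12, h13⟩, ho⟩, hb⟩
      refine ⟨⟨⟨ho, hb⟩, ?_⟩, h13⟩
      intro x hx
      rcases hx with rfl | rfl
      · exact fun h' => h12 (conn_symm h')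
      · exact fun h' => h12 (conn_trans h13 (conn_symm h'))
  have e2 : connEvent ends a₂ o ∩ connEvent ends a₁ b ∩ avoidAll ends a₂ {a₁, a₃} ∩
      (connEvent ends a₁ a₃)ᶜ = PDEvent ends a₁ a₂ a₃ ∩ connEvent ends a₂ o ∩ connEvent ends a₁ b := by
    ext ω
    simp only [Set.mem_inter_iff, mem_connEvent, avoidAll, Finset.mem_insert, Finset.mem_singleton,
      PDEvent, Dtilde, inU, Set.mem_compl_iff, Set.mem_union]
    constructor
    · rintro ⟨⟨⟨ho, hb⟩, hR⟩, h13⟩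
      exact ⟨⟨⟨fun h' => hR _ (Or.inl rfl) (conn_symm h'), fun h' => h'.elim
        (fun h' => h13 (conn_symm h')) (fun h' => hR _ (Or.inr rfl) (conn_symm h'))⟩, ho⟩, hb⟩
    · rintro ⟨⟨⟨h12, h3⟩, ho⟩, hb⟩
      refine ⟨⟨⟨ho, hb⟩, ?_⟩, fun h' => h3 (Or.inl (conn_symm h'))⟩
      intro x hx
      rcases hx with rfl | rfl
      · exact fun h' => h12 (conn_symm h')
      · exact fun h' => h3 (Or.inr (conn_symm h'))
  rw [e1, e2] at h
  rw [add_comm]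
  exact h

omit [Fintype V] [LinearOrder R] [IsStrictOrderedRing R] in
/-- Heavy bookkeeping: `T_{h→l} − Δ_h = P(o ∈ C₂, b ∈ C₁, R_h) − P(o ∈ C₂, b ∈ C₂, T′)`. -/
lemma Thl_sub_deltaH (p : E → R) (ends : E → Sym2 V) (o a₁ a₂ a₃ b : V) :
    prob p (PDEvent ends a₁ a₂ a₃ ∩ connEvent ends a₂ o ∩ connEvent ends a₁ b) -
        deltaH p ends o a₁ a₂ a₃ b =
      prob p (connEvent ends a₂ o ∩ connEvent ends a₁ b ∩ avoidAll ends a₂ {a₁, a₃}) -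
        prob p (connEvent ends a₂ o ∩ connEvent ends a₂ b ∩ TEvent ends a₂ a₁ a₃) := by
  have h := prob_PD_add_T_ob_heavy p ends o a₁ a₂ a₃ b
  have e : TEvent ends a₂ a₁ a₃ ∩ connEvent ends a₂ o ∩ connEvent ends a₂ b =
      connEvent ends a₂ o ∩ connEvent ends a₂ b ∩ TEvent ends a₂ a₁ a₃ := by
    ext ω
    simp only [Set.mem_inter_iff]
    tauto
  unfold deltaH
  rw [e, ← h]
  ring

omit [Fintype V] in
/-- **The principal up-set `{S | o ∈ S}` is exactly (Yu2Δ)**: `SDHeavy {S | o ∈ S} ↔ Yu2Delta`. -/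
theorem SDHeavy_principal_iff (p : E → R) (ends : E → Sym2 V) (o a₁ a₂ a₃ b : V) :
    SDHeavy p ends a₁ a₂ a₃ b {S | o ∈ S} ↔ Yu2Delta p ends o a₁ a₂ a₃ b := by
  unfold SDHeavy Yu2Delta
  rw [clusterInEvent_principal]
  have e1 : connEvent ends a₁ b ∩ connEvent ends a₂ o ∩ avoidAll ends a₂ {a₁, a₃} =
      connEvent ends a₂ o ∩ connEvent ends a₁ b ∩ avoidAll ends a₂ {a₁, a₃} := by
    rw [Set.inter_comm (connEvent ends a₁ b)]
  have e2 : connEvent ends a₂ b ∩ connEvent ends a₂ o ∩ TEvent ends a₂ a₁ a₃ =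
      connEvent ends a₂ o ∩ connEvent ends a₂ b ∩ TEvent ends a₂ a₁ a₃ := by
    rw [Set.inter_comm (connEvent ends a₂ b)]
  rw [e1, e2, ← Thl_sub_deltaH]
  constructor
  · intro h
    linarith
  · intro h
    linarith

omit [Fintype V] [LinearOrder R] [IsStrictOrderedRing R] in
/-- `R_h = PD ⊔ T′` in mass: `P(b ∈ C₁, R_h) = P(PD, b ∈ C₁) + P(b ∈ C₁, T′)`. -/
lemma Nl_eq_heavy (p : E → R) (ends : E → Sym2 V) (a₁ a₂ a₃ b : V) :
    prob p (connEvent ends a₁ b ∩ avoidAll ends a₂ {a₁, a₃}) =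
      prob p (PDEvent ends a₁ a₂ a₃ ∩ connEvent ends a₁ b) +
        prob p (connEvent ends a₁ b ∩ TEvent ends a₂ a₁ a₃) := by
  have h := prob_PD_add_T_ob_heavy p ends a₂ a₁ a₂ a₃ b
  have hself : connEvent ends a₂ a₂ = Set.univ := by
    ext ω
    simp only [mem_connEvent, Set.mem_univ, iff_true]
    exact conn_refl ends ω a₂
  simp only [hself, Set.inter_univ, Set.univ_inter] at h
  have e : TEvent ends a₂ a₁ a₃ ∩ connEvent ends a₁ b = connEvent ends a₁ b ∩ TEvent ends a₂ a₁ a₃ :=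
    Set.inter_comm _ _
  rw [e] at h
  exact h.symm

omit [Fintype V] [IsStrictOrderedRing R] in
/-- `𝒰 = univ` on the heavy side: `[P(b ∈ C₁, R_h) − P(b ∈ C₂, T′)] · P(PD) ≤ P(PD) · W`, i.e.
`M₁ + Δ′_T ≤ M₂ + Δ_T` — the heavy `Λ(Ω)` is at most the light one; this is `W_h ≥ W_l`
(= the labelling-type hypothesis, see `SDHeavy_univ_iff`). -/
theorem SDHeavy_univ_iff (p : E → R) (ends : E → Sym2 V) (a₁ a₂ a₃ b : V) :
    SDHeavy p ends a₁ a₂ a₃ b Set.univ ↔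
      (prob p (PDEvent ends a₁ a₂ a₃ ∩ connEvent ends a₁ b) +
          prob p (connEvent ends a₁ b ∩ TEvent ends a₂ a₁ a₃) -
          prob p (connEvent ends a₂ b ∩ TEvent ends a₂ a₁ a₃)) * prob p (PDEvent ends a₁ a₂ a₃) ≤
        prob p (PDEvent ends a₁ a₂ a₃) * (massM2 p ends a₁ a₂ a₃ b + deltaT p ends a₁ a₂ a₃ b) := by
  unfold SDHeavy
  rw [clusterInEvent_univ]
  simp only [Set.inter_univ]
  rw [Nl_eq_heavy]

omit [Fintype V] in
/-- (Yu2Δ) follows from (SD)_h on up-sets. -/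
theorem Yu2Delta_of_SDHeavyUp (p : E → R) (ends : E → Sym2 V) (o a₁ a₂ a₃ b : V)
    (h : SDHeavyUp p ends a₁ a₂ a₃ b) : Yu2Delta p ends o a₁ a₂ a₃ b :=
  (SDHeavy_principal_iff p ends o a₁ a₂ a₃ b).1 (h _ (fun _ _ hST ho => hST ho))

end SDHeavyFacts

end Summit.Ventures.PercRepro2
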